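/-
Copyright: statement-level skeleton of a published paper (lit-balaban cell, Phase-2 proof seat p31, gen 24). No proof claims beyond what the
kernel checks below.
-/
import Literature.MathematicalPhysics.QuantumFieldTheory.BalabanImbrieJaffe1984to88.BIJ88Eq249GaugeCovarianceUniformTorus
import Literature.MathematicalPhysics.QuantumFieldTheory.BalabanImbrieJaffe1984to88.BIJ88Eq242HiggsCovarianceTorus

/-!
# `BalabanImbrieJaffe1984to88.BIJ88Eq245HiggsCovarianceUniformTorus` — T. Bałaban, J. Imbrie, A. Jaffe, *Effective action and cluster properties of
the abelian Higgs model*, Commun. Math. Phys. **114** (1988) 257–315 [BalabanImbrieJaffe1988], §2 pp. 264–265 [PDF 8–9], **(2.42), (2.45), (2.41),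
(2.46), (2.47) FOR THE SCALAR SINGLE-SCALE PROPAGATOR `C^{(k)}_Λ(u)` WITH THE CUBE SIZE FIXED FIRST** — p. 264: *"As in [6], there is a random walk
expansion for C^{(k)}_Λ(u), C^{(k)}_Λ(u; x₁, x₂) = Σ_ω C^{(k)}_{Λ,ω}(u, x₁, x₂), (2.42) … where ω is a walk on a lattice of spacing M = O(1)"*;
[6] = [Balaban1983RegularityDecay] p. 595 *"(5.15) for α depending on M and arbitrarily small if M is sufficiently large"*, p. 596 *"Finally we fix
M"*.  Gen 23's `BIJ88Eq242HiggsCovarianceTorus` §6 proves the five rows for the model's `C^{(k)}_Λ(u) = [(Δ + κP(u))|_Λ]^{−1}` at a small field for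
EVERY cube size `M` above p13's [6]-thresholds `K_R`, `Θ₁` (and with `θ_W(M) < 1`, and `s` labels with `K₀ ≤ e^{cs}` for (2.46)) — thresholds
that are functions of `(d, L)` and of the constants `γ, κ, σ, E, c_Δ, δ₀` of the (2.38)/(2.36)-shape hypotheses, NOT of `Λ`, `u` or `Δ`.  Here they
are discharged once and for all by gen 24's `exists_cubeSize` (the choice of pub-balaban's `concl57_walk`: `θ_W(M) ≤ ½`, so `(1 − θ_W)⁻¹ ≤ 2`):
ONE theorem with `∃ M s₀` BEFORE `∀ Λ u Δ`.

statement-level skeleton of published theorems with citation tags; proofs where landed; nothing here is a claim about the Yang–Mills mass gap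

PDF held: `paper:balaban1988-cmp114-bij-abelian-higgs-effective-action` (journal page = PDF page + 256; p. 264 = PDF 8 re-read this session: the
(2.42) sentence with *"M = O(1)"* is p0008 l.16–19); `paper:balaban1983-cmp89-regularity-decay` (pp. 595–596 = PDF 25–26 re-read this session).

CITATION HEADER (lean-in-tree rule).  lit-balaban cell (HOME `run/shared/lean/pub/lit-balaban/`), Phase 2, proof seat **p31 gen 24** (unit `lit-balaban-p31`,
literature-prover-lit-balaban-p31-g24-0), free-target protocol G.5-34(d), TAKING #5 line HOME/STATUS.md (window 20 min; stem check
`245Higgs|HiggsCovarianceUniform|Eq245` = ∅; cc r18, p13).  Rows served (CELLS, located members; heads unchanged): `HOME/lit-balaban-r18/ROWS-C2.md`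
**C2.Eq2.42**, **C2.Eq2.45**, C2.Eq2.41, C2.Eq2.46, C2.Eq2.47.  Files USED BY NAME, nothing restated: gen 23 `BIJ88Eq242HiggsCovarianceTorus` (`cdist`,
`chartSet`, `idxEquiv`, `reOp`, `eq242_smallField`, `eq245_smallField`, `decay241_walk_smallField`, `close247_smallField`, `ineq246_smallField`); gen 24
`BIJ88Eq249GaugeCovarianceUniformTorus` (`exists_cubeSize`, `inv_one_sub_le_two`); p10/p11/p02 vocabulary through gen 23's imports (`realify`, `compress`,
`op240`, `c240`, `GaugeField`, `U1`, `toC`, `blkIter`, `holCK`); p13 `BIJ88RandomWalk242` / `BIJ88Eq242Lattice` / `BIJ88Ineq246Lattice` / `B4Sect5CubeBounds`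
(`cLoc`, `cX`, `memX`, `latticeCw`, `Walk`, `labels`, `ldist`, `cubeOf`, `touch`, `Cubes`, `InBox`, `thetaW`, `K0`); r18 `BIJ88Sect2Statements`
(`Eq245`, `Ineq246`, `Close`).

## What is proved (0 `sorry`; axioms standard; theorems only)

* **`smallField_uniform`** — for `j + 1 ≤ m + K`, `γ ≥ 0`, `κ ≥ 0`, `σ`, `E < c₀(γ,κ)(1 − σ)`, `c_Δ ≥ 0`, `δ₀ > 0`: `∃ M ≥ 5, s₀` such that for every `Λ`,
  every `u` with `|u(b) − 1| ≤ T` inside the blocks and holonomy deviation `≤ δ` with `2(L−1)L·d·T² + 2δ² ≤ σ`, every Hermitian `Δ` with the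
  (2.38)-shape lower bound on fields supported in `Λ` and the (2.36)-shape kernel bound on `Λ × Λ`: `Eq245` (all `ρ`, `s`) ∧ the unconditional walk
  expansion (2.42) ∧ `‖C^{(k)}_Λ(u; x₁, x₂)‖ ≤ 2·2^{d+1}γ₀⁻¹e^{δ₀/4}·e^{−(δ₀/8)|x₁−x₂|_{T^{(k)}}/M}` (`γ₀ = c₀(γ,κ)(1−σ) − E`) ∧ `Close` with
  `δ = 2^{d+1}γ₀⁻¹e^{−(δ₀/16)(ρ−3)}`, `c = δ₀/16` (all `ρ`) ∧ `Ineq246` with `c = δ₀/(128·9^d)` (all `s ≥ s₀`); private `le_exp_mul_of_ge`.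
HONEST SCOPE.  (i) Exactly gen 23's small-field abstraction level (hypotheses (2.38)-shape / (2.36)-shape on `Δ`, smallness of `u` through `T, δ, σ`);
the members at the actual background field (`BIJ88Eq242HiggsCovarianceActualBackground`, `…PrintNorm…`) inherit the same discharge by the same three
lines and are not restated here.  (ii) `M`, `s₀` existential (recipes in the proofs); no optimality.  (iii) `s ≥ s₀` is the print's *"r(e_k) → ∞"*
(p. 260) as an eventual statement.  No `def`, no new named fact (D-0026).  Unit `lit-balaban-p31` (literature-prover-lit-balaban-p31-g24-0), 2026-08-23.
NOT summit progress.
-/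

open scoped BigOperators Matrix ComplexConjugate
open Finset Matrix

namespace Literature.MathematicalPhysics.QuantumFieldTheory.BalabanImbrieJaffe1984to88.BIJ88Eq245HiggsCovarianceUniformTorus

open Literature.MathematicalPhysics.QuantumFieldTheory.Balaban1983to89
open BIJ88Sect3Statements (U1 toC)
open BIJ85BlockAveragesTorus BIJ85BlockAveragesTorusK
open BIJ88Eq240FlatTorus (realify compress op240 c240)
open BIJ88RandomWalk242 BIJ88Eq242Lattice BIJ88Ineq246Lattice B4Sect5CubeBounds
open BIJ88Eq242HiggsCovarianceTorus
open BIJ88Eq249GaugeCovarianceUniformTorus (exists_cubeSize inv_one_sub_le_two)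

noncomputable section

variable {P : Params} {j : ℕ}

/-- kernel: `e^{as} ≥ K` as soon as `s ≥ K/a` (`a > 0`), by `e^x ≥ x + 1`. [folklore] -/
private theorem le_exp_mul_of_ge {a K : ℝ} (ha : 0 < a) {s : ℕ} (hs : K / a ≤ s) : K ≤ Real.exp (a * s) := by
  have h1 : K ≤ a * s := by rwa [div_le_iff₀' ha] at hs
  linarith [Real.add_one_le_exp (a * s)]

/-- **(2.42)/(2.45)/(2.41)/(2.46)/(2.47) FOR THE MODEL'S `C^{(k)}_Λ(u) = [(Δ + κP(u))|_Λ]^{−1}` AT A SMALL FIELD WITH THE CUBE SIZE FIXED FIRST** — p. 264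
*"(2.42) where ω is a walk on a lattice of spacing M = O(1)"*, [6] p. 596 *"Finally we fix M"*: on `T^{(k)}` (any level with a next one), for all
constants `γ ≥ 0`, `κ ≥ 0`, `σ`, `E < c₀(γ,κ)(1 − σ)`, `c_Δ ≥ 0`, `δ₀ > 0` there are a cube size `M ≥ 5` and a label count `s₀` — depending on these
and on `(d, L)` ONLY — such that for EVERY region `Λ`, EVERY bond field `u` with `|u(b) − 1| ≤ T` inside the blocks and holonomy deviation `≤ δ`,
`2(L−1)L·d·T² + 2δ² ≤ σ`, and EVERY Hermitian `Δ` with the (2.38)-shape lower bound (`γ`, `E`) on fields supported in `Λ` and the (2.36)-shape kernel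
bound (`c_Δ`, `δ₀`) on `Λ × Λ`: (2.45) `Eq245` (every `ρ`, `s`) ∧ (2.42) the unconditional walk expansion ∧ (2.41) by the walk route
`‖C^{(k)}_Λ(u; x₁, x₂)‖ ≤ 2·2^{d+1}γ₀^{−1}e^{δ₀/4}·e^{−(δ₀/8)|x₁−x₂|_{T^{(k)}}/M}` (`γ₀ = c₀(γ,κ)(1−σ) − E`) ∧ (2.47) `Close` with
`δ = 2^{d+1}γ₀^{−1}e^{−(δ₀/16)(ρ−3)}`, `c = δ₀/16` (every `ρ`) ∧ (2.46) `Ineq246` with `c = δ₀/(128·9^d)` (every `s ≥ s₀`) — gen 23's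
`eq245_smallField` / `eq242_smallField` / `decay241_walk_smallField` / `close247_smallField` / `ineq246_smallField` with their cube thresholds
discharged by gen 24's `exists_cubeSize` (`θ_W ≤ ½`). [cite: BalabanImbrieJaffe1988, (2.41)–(2.42) p.264, (2.45)–(2.47) pp.264–265;
Balaban1983RegularityDecay, (5.15) p.595, p.596] -/
theorem smallField_uniform (hj : j + 1 ≤ P.m + P.K) {γ E κ σ cΔ δ₀ : ℝ} (hγ : 0 ≤ γ) (hκ : 0 ≤ κ) (hE : E < c240 P γ κ * (1 - σ))
    (hcΔ : 0 ≤ cΔ) (hδ₀ : 0 < δ₀) :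
    ∃ M s₀ : ℕ, 5 ≤ M ∧ ∀ (Λ : Finset (Balaban1983to89.Site P j)) (U : GaugeField P j U1) (T δ : ℝ),
      (∀ b : PBond P j, blkIter 1 b.src = blkIter 1 b.tgt → ‖toC (U b) - 1‖ ≤ T) →
      (∀ x : Balaban1983to89.Site P j, ‖holCK U 1 x - 1‖ ≤ δ) →
      2 * (((P.L : ℝ) - 1) * P.L) * P.d * T ^ 2 + 2 * δ ^ 2 ≤ σ →
      ∀ (Δ : Matrix (Balaban1983to89.Site P j) (Balaban1983to89.Site P j) ℂ), Δ.IsHermitian →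
      (∀ φ : Balaban1983to89.Site P j → ℂ, (∀ x ∉ Λ, φ x = 0) →
        γ * ∑ b : PBond P j, ‖toC (U b) * φ b.tgt - φ b.src‖ ^ 2 - E * ∑ x, ‖φ x‖ ^ 2 ≤ (star φ ⬝ᵥ (Δ *ᵥ φ)).re) →
      (∀ x₁ ∈ Λ, ∀ x₂ ∈ Λ, ‖Δ x₁ x₂‖ ≤ cΔ * Real.exp (-(δ₀ * cdist x₁ x₂))) →
      (∀ (ρ : ℝ) (s : ℕ), BIJ88Sect2Statements.Eq245 (fun p q : ↥Λ × Fin 2 => realify (compress Λ (op240 Δ κ U))⁻¹ p q)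
        (fun p q => cLoc (ldist (N := 2) M) ρ (fun ω y₁ y₂ => latticeCw M (chartSet Λ) 2 (reOp Λ (op240 Δ κ U)) ω y₁ y₂)
          (idxEquiv Λ p) (idxEquiv Λ q))
        (fun X p q => cX (ldist (N := 2) M) ρ (cubeOf M s) touch (fun ω y₁ y₂ => latticeCw M (chartSet Λ) 2 (reOp Λ (op240 Δ κ U)) ω y₁ y₂) X
          (idxEquiv Λ p) (idxEquiv Λ q))) ∧
      (∀ x₁ x₂ : ↥Λ, HasSum (fun ω : Walk ↥(labels M (chartSet Λ)) =>
          (⟨latticeCw M (chartSet Λ) 2 (reOp Λ (op240 Δ κ U)) ω (idxEquiv Λ (x₁, 0)) (idxEquiv Λ (x₂, 0)),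
            latticeCw M (chartSet Λ) 2 (reOp Λ (op240 Δ κ U)) ω (idxEquiv Λ (x₁, 1)) (idxEquiv Λ (x₂, 0))⟩ : ℂ))
        ((compress Λ (op240 Δ κ U))⁻¹ x₁ x₂)) ∧
      (∀ x₁ x₂ : ↥Λ, ‖(compress Λ (op240 Δ κ U))⁻¹ x₁ x₂‖ ≤
        2 * (2 ^ (P.d + 1) * (c240 P γ κ * (1 - σ) - E)⁻¹ * Real.exp (δ₀ / 4)) * Real.exp (-(δ₀ / 8) * (B5Ineq137Torus.T P j x₁.1 x₂.1 / M))) ∧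
      (∀ ρ : ℝ, BIJ88Sect2Statements.Close (fun p q : ↥Λ × Fin 2 => cdist p.1.1 q.1.1 / M)
        (fun p q => cLoc (ldist (N := 2) M) ρ (fun ω y₁ y₂ => latticeCw M (chartSet Λ) 2 (reOp Λ (op240 Δ κ U)) ω y₁ y₂)
          (idxEquiv Λ p) (idxEquiv Λ q))
        (fun p q => realify (compress Λ (op240 Δ κ U))⁻¹ p q)
        (2 ^ (P.d + 1) * (c240 P γ κ * (1 - σ) - E)⁻¹ * Real.exp (-(δ₀ / 16 * (ρ - 3)))) (δ₀ / 16)) ∧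
      (∀ s : ℕ, s₀ ≤ s → BIJ88Sect2Statements.Ineq246 (fun X : Finset (Cubes M s (chartSet Λ)) => X.card)
        (fun (p : ↥Λ × Fin 2) (X : Finset (Cubes M s (chartSet Λ))) =>
          memX (fun (x : B4.Idx (chartSet Λ) 2) (l : ↥(labels M (chartSet Λ))) => InBox M l.1 (x.1 : Fin P.d → ℤ)) (cubeOf M s) touch
            (idxEquiv Λ p) X)
        (fun X p q => cX (ldist (N := 2) M) ((s : ℝ) / 4) (cubeOf M s) touch
          (fun ω y₁ y₂ => latticeCw M (chartSet Λ) 2 (reOp Λ (op240 Δ κ U)) ω y₁ y₂) X (idxEquiv Λ p) (idxEquiv Λ q))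
        (δ₀ / (128 * 9 ^ P.d)) s) := by
  set γ₀ := c240 P γ κ * (1 - σ) - E with hγ₀def
  set c₀ := cΔ + κ * (((P.L : ℝ) ^ P.d)⁻¹) ^ 2 * Real.exp (δ₀ * ((P.L : ℝ) - 1)) with hc₀def
  have hγ₀ : 0 < γ₀ := by rw [hγ₀def]; linarith
  have hc₀ : 0 ≤ c₀ := by rw [hc₀def]; positivity
  obtain ⟨M, hM5, hMR, hMθ, hθhalf⟩ := exists_cubeSize P.d 2 (γ₀ := γ₀) (c₀ := c₀) (δ₀ := δ₀) hγ₀ hc₀ hδ₀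
  have hθW : thetaW P.d 2 γ₀ c₀ δ₀ M < 1 := by linarith
  have hinv : (1 - thetaW P.d 2 γ₀ c₀ δ₀ M)⁻¹ ≤ 2 := inv_one_sub_le_two hθhalf
  refine ⟨M, max 1 ⌈(2 ^ (P.d + 1) * γ₀⁻¹ * Real.exp (δ₀ / 8)) / (δ₀ / (128 * 9 ^ P.d))⌉₊, hM5,
    fun Λ U T δ hInt hTree hσ Δ hΔ h238 hker => ⟨fun ρ s => ?_, fun x₁ x₂ => ?_, fun x₁ x₂ => ?_, fun ρ => ?_, fun s hs => ?_⟩⟩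
  · exact eq245_smallField hj U hInt hTree hσ hΔ hγ hκ hE h238 hcΔ hδ₀ hker hM5 hMR hMθ ρ s
  · exact eq242_smallField hj U hInt hTree hσ hΔ hγ hκ hE h238 hcΔ hδ₀ hker hM5 hMR hMθ x₁ x₂
  · refine (decay241_walk_smallField hj U hInt hTree hσ hΔ hγ hκ hE h238 hcΔ hδ₀ hker hM5 hMR hMθ hθW x₁ x₂).trans ?_
    have hE' := Real.exp_pos (-(δ₀ / 8) * (B5Ineq137Torus.T P j x₁.1 x₂.1 / M))
    calc 2 * (2 ^ P.d * γ₀⁻¹ * (1 - thetaW P.d 2 γ₀ c₀ δ₀ M)⁻¹ * Real.exp (δ₀ / 4)) *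
          Real.exp (-(δ₀ / 8) * (B5Ineq137Torus.T P j x₁.1 x₂.1 / M))
        ≤ 2 * (2 ^ P.d * γ₀⁻¹ * 2 * Real.exp (δ₀ / 4)) * Real.exp (-(δ₀ / 8) * (B5Ineq137Torus.T P j x₁.1 x₂.1 / M)) := by gcongr
      _ = _ := by ring
  · intro p q
    refine (close247_smallField hj U hInt hTree hσ hΔ hγ hκ hE h238 hcΔ hδ₀ hker hM5 hMR hMθ hθW ρ p q).trans ?_
    have hE' := Real.exp_pos (-(δ₀ / 16) * (cdist p.1.1 q.1.1 / M))
    calc 2 ^ P.d * γ₀⁻¹ * (1 - thetaW P.d 2 γ₀ c₀ δ₀ M)⁻¹ * Real.exp (-(δ₀ / 16 * (ρ - 3))) * Real.exp (-(δ₀ / 16) * (cdist p.1.1 q.1.1 / M))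
        ≤ 2 ^ P.d * γ₀⁻¹ * 2 * Real.exp (-(δ₀ / 16 * (ρ - 3))) * Real.exp (-(δ₀ / 16) * (cdist p.1.1 q.1.1 / M)) := by gcongr
      _ = _ := by ring
  · have hs1 : 0 < s := lt_of_lt_of_le Nat.one_pos ((le_max_left _ _).trans hs)
    have hK0 : K0 P.d 2 γ₀ c₀ δ₀ M ≤ Real.exp (δ₀ / (128 * 9 ^ P.d) * s) := by
      have h1 : K0 P.d 2 γ₀ c₀ δ₀ M ≤ 2 ^ (P.d + 1) * γ₀⁻¹ * Real.exp (δ₀ / 8) := by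
        unfold K0
        calc 2 ^ P.d * γ₀⁻¹ * (1 - thetaW P.d 2 γ₀ c₀ δ₀ M)⁻¹ * Real.exp (δ₀ / 8)
            ≤ 2 ^ P.d * γ₀⁻¹ * 2 * Real.exp (δ₀ / 8) := by gcongr
          _ = _ := by ring
      refine h1.trans (le_exp_mul_of_ge (by positivity) ?_)
      have h2 : ⌈(2 ^ (P.d + 1) * γ₀⁻¹ * Real.exp (δ₀ / 8)) / (δ₀ / (128 * 9 ^ P.d))⌉₊ ≤ s := (le_max_right _ _).trans hs
      exact (Nat.le_ceil _).trans (by exact_mod_cast h2)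
    exact ineq246_smallField hj U hInt hTree hσ hΔ hγ hκ hE h238 hcΔ hδ₀ hker hM5 hMR hMθ hθW hs1 hK0

end

end Literature.MathematicalPhysics.QuantumFieldTheory.BalabanImbrieJaffe1984to88.BIJ88Eq245HiggsCovarianceUniformTorus
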